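import Literature.Algebra.Homology.FreeComplexDualAcyclic
import Literature.Algebra.Homology.TorsionCocyclesOfQuasiIso
import Mathlib.Algebra.Homology.Embedding.CochainComplex
import Mathlib.RingTheory.LocalRing.Module
import HarnessLib

/-!
# The dual of a finite free complex exact below `g` with surjective `d^g` is exact in degrees `[-g, 0)`
# ([MumfordAV1970] §13 via the canonical truncation `τ_{≤ g}`; [Weibel1994] 1.2.7)

Layer `Literature/Algebra/Homology`, namespace `Literature.Algebra.Homology`.  THEOREMS ONLY (Mathlib + ★ B2 `FreeComplexDualAcyclic` + ★ J4
`TorsionCocyclesOfQuasiIso`; no definition, no named fact, no instance, no notation, no `sorry`).  Junction (R1) «top-degree truncation» of the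
duality-free «H1-DIM any characteristic» cut of the DUAL-S road (cell hodgecm-mathlib): ★ B2 `homComplex_exactAt_of_neg` wants a finite free complex
`K•` VANISHING above `g` (`g` = the length of the weakly regular sequence, `= dim 𝒪_{Â,0̂}`), whereas the Grothendieck complex of a line bundle for a
`(g+1)`-member affine cover (★ `Relative.grothendieckComplex`, amplitude `[0, #ι] = [0, g+1]`) only has NO COHOMOLOGY above `g` — equivalently, since
`K^{g+2} = 0`, its top differential `d^g : K^g → K^{g+1}` is SURJECTIVE.  This file removes the discrepancy without touching any definition.

* §1 Linear algebra: a surjection `d : P ↠ Q` onto a projective module splits off its kernel — a linear form killing `ker d` factors through `d`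
  (`exists_eq_comp_of_ker_le_ker`), and an injection `ι : Z ↪ P` with image `ker d` has a retraction (`exists_retraction_of_range_eq_ker`).
* §2 TRANSFER along a cochain map `ι : K' → K` of complexes of `R`-modules which is bijective in degrees `< g`, injective in degree `g`, a
  quasi-isomorphism in degrees `≤ g`, with `K'` vanishing above `g` and `d^g_K` surjective onto a projective `K^{g+1}` (the shape of the canonical
  truncation `τ_{≤ g} K → K`): `g`-cocycles of `K` lie in the image of `ι^g` (`ker_d_le_range_of_quasiIsoAt`); exactness of `Hom_R(K'•, M)` at a degree
  `p ∈ [-g, 0)` implies exactness of `Hom_R(K•, M)` at `p` (`exact_lcomp_of_exact_lcomp_of_surjective`, `exact_lcomp_of_exact_lcomp_top`); and ★ B2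
  applied to `K'` — whose hypotheses (finite free terms over a LOCAL ring, exactness below `g`, power-torsion of `H^g`) are read off `K` through `ι`
  (★ J4 `exists_pow_smul_eq_d_of_homologyMap_injective`, Mathlib `exactAt_iff_of_quasiIsoAt`, `Module.Projective.of_split`,
  `Module.free_of_flat_of_isLocalRing`) — gives **`homComplex_exactAt_of_neg_of_topReplacement`**.
* §3 Mathlib's canonical truncation `K.truncLE g` is such a `K'` (`isIso_ιTruncLE_f`, the instances `QuasiIsoAt (K.ιTruncLE g) q`, `q ≤ g`, and
  `(K.truncLE g).IsStrictlyLE g`), whence the hypothesis-free form **`homComplex_exactAt_of_surjective_d_top`**: for `R` LOCAL carrying a weakly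
  regular sequence of length `≥ g`, `K•` a cochain complex of finite free `R`-modules, exact at every degree `< g`, with `d^g : K^g ↠ K^{g+1}`
  surjective and every member of the sequence acting locally nilpotently on `H^g(K•) = ker d^g / im d^{g-1}`, the dual `Hom_R(K•, R)` is exact at
  every degree `-g ≤ p < 0`; in particular at `p = -1` (`g ≥ 1`), the hypothesis `h₂` of ★
  `finrank_HOne_baseChangeComplex_residueField_eq_finrank_cotangentSpace`.

This is [MumfordAV1970] §13's local algebra («both `K•` and `Hom(K•, 𝒪)` are resolutions»), made independent of the amplitude of the chosen
strictly perfect model by the good truncation `τ_{≤ g}` of [Weibel1994] 1.2.7.  HC_CM is proved only modulo the 7 printed citations until rung 0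
closes; this file discharges none of them (count-neutral capital).

## References
* [MumfordAV1970] D. Mumford, *Abelian Varieties* (1970), §13 (pp. 125–130).
* [Weibel1994] C. Weibel, *An introduction to homological algebra* (1994), §1.1 (p. 2) and 1.2.7–1.2.8 (pp. 9–10) (truncations `τ_{≤ n}`,
  quasi-isomorphisms).
* [BrunsHerzog1998] W. Bruns, J. Herzog, *Cohen–Macaulay rings*, rev. ed. (1998), §1.1 (p. 4), §1.3 (pp. 16–17) (duals of finite free
  complexes).
* [PeskineSzpiro1973] C. Peskine, L. Szpiro, *Dimension projective finie et cohomologie locale*, Publ. Math. IHÉS 42 (1973), Lemme (1.8).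
-/

universe u

open CategoryTheory CategoryTheory.Limits HomologicalComplex RingTheory.Sequence

namespace Literature.Algebra.Homology

/-! ## §1 A surjection onto a projective module splits off its kernel -/

section Split

variable {R : Type u} [CommRing R] {Z P Q M : Type u} [AddCommGroup Z] [Module R Z] [AddCommGroup P] [Module R P]
  [AddCommGroup Q] [Module R Q] [AddCommGroup M] [Module R M]

/-- **A linear map killing the kernel of a surjection factors through it**: `ker d ≤ ker φ`, `d` onto ⇒ `φ = ψ ∘ d`.
[cite: BrunsHerzog1998, §1.1 (p. 4)] [cite: Weibel1994, §1.1 (p. 2)] -/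
theorem exists_eq_comp_of_ker_le_ker (d : P →ₗ[R] Q) (hd : Function.Surjective d) (φ : P →ₗ[R] M)
    (hφ : LinearMap.ker d ≤ LinearMap.ker φ) : ∃ ψ : Q →ₗ[R] M, φ = ψ ∘ₗ d := by
  refine ⟨(LinearMap.ker d).liftQ φ hφ ∘ₗ (d.quotKerEquivOfSurjective hd).symm.toLinearMap, ?_⟩
  ext x
  have hx : (d.quotKerEquivOfSurjective hd).symm (d x) = Submodule.Quotient.mk x := by
    rw [LinearEquiv.symm_apply_eq]
    rfl
  show φ x = (LinearMap.ker d).liftQ φ hφ ((d.quotKerEquivOfSurjective hd).symm (d x))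
  rw [hx, Submodule.liftQ_apply]

/-- **A surjection onto a projective module splits off its kernel**: if `ι : Z → P` is injective with image `ker d` for a surjection
`d : P ↠ Q` onto a PROJECTIVE module, then `ι` has a retraction `s ∘ ι = id` (`s = ι⁻¹ ∘ (1 - σ d)` for a section `σ` of `d`).  Hence `Z` is a
direct summand of `P`: finitely generated, resp. projective, when `P` is. [cite: BrunsHerzog1998, §1.1 (p. 4)] [cite: Weibel1994, §1.1 (p. 2)] -/
theorem exists_retraction_of_range_eq_ker [Module.Projective R Q] (ι : Z →ₗ[R] P) (hι : Function.Injective ι)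
    (d : P →ₗ[R] Q) (hd : Function.Surjective d) (hr : LinearMap.range ι = LinearMap.ker d) :
    ∃ s : P →ₗ[R] Z, s ∘ₗ ι = LinearMap.id := by
  obtain ⟨σ, hσ⟩ := Module.projective_lifting_property d LinearMap.id hd
  have hπ : ∀ x, (LinearMap.id - σ ∘ₗ d : P →ₗ[R] P) x ∈ LinearMap.range ι := fun x => by
    rw [hr, LinearMap.mem_ker, LinearMap.sub_apply, map_sub, LinearMap.comp_apply, ← LinearMap.comp_apply (f := d) (g := σ),
      hσ, LinearMap.id_apply, LinearMap.id_apply, sub_self]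
  refine ⟨(LinearEquiv.ofInjective ι hι).symm.toLinearMap ∘ₗ LinearMap.codRestrict _ (LinearMap.id - σ ∘ₗ d) hπ, ?_⟩
  ext z
  have hdz : d (ι z) = 0 := by
    rw [← LinearMap.mem_ker, ← hr]
    exact LinearMap.mem_range_self ι z
  have hval : LinearMap.codRestrict _ (LinearMap.id - σ ∘ₗ d : P →ₗ[R] P) hπ (ι z) = LinearEquiv.ofInjective ι hι z := by
    apply Subtype.ext
    rw [LinearMap.codRestrict_apply, LinearEquiv.ofInjective_apply, LinearMap.sub_apply, LinearMap.comp_apply, hdz, map_zero,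
      sub_zero, LinearMap.id_apply]
  rw [LinearMap.comp_apply, LinearMap.comp_apply, LinearMap.id_apply, hval, LinearEquiv.coe_coe, LinearEquiv.symm_apply_apply]

end Split

/-! ## §2 Transfer along a top replacement `ι : K' → K` -/

section Transfer

variable {R : Type u} [CommRing R] {K' K : CochainComplex (ModuleCat.{u} R) ℤ} (ι : K' ⟶ K)

/-- A cochain map commutes with the differentials, on elements (private helper). [folklore] -/
private theorem topRepl_comm_apply (i j : ℤ) (x : K'.X i) : (K.d i j).hom ((ι.f i).hom x) = (ι.f j).hom ((K'.d i j).hom x) := by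
  have := congrArg (fun φ => φ.hom x) (ι.comm i j)
  simpa only [ModuleCat.hom_comp, LinearMap.comp_apply] using this

/-- `d ∘ d = 0` on elements (private helper). [folklore] -/
private theorem topRepl_d_d_apply (L : CochainComplex (ModuleCat.{u} R) ℤ) (i j l : ℤ) (x : L.X i) : (L.d j l).hom ((L.d i j).hom x) = 0 := by
  rw [← ModuleCat.comp_apply, L.d_comp_d]
  rfl

/-- **Surjectivity of `Hⁿ(ι)`, elementwise**: if `Hⁿ(ι)` is onto, every `n`-cocycle `z` of `K` is `ι x - d h` for an `n`-cocycle `x` of `K'` and a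
cochain `h` of `K`. [cite: Weibel1994, §1.1 (p. 2)] -/
theorem exists_eq_add_d_of_homologyMap_surjective (n : ℤ) (hsurj : Function.Surjective (homologyMap ι n).hom)
    (z : K.X n) (hz : (K.d n (n + 1)).hom z = 0) :
    ∃ (x : K'.X n) (h : K.X (n - 1)), (K'.d n (n + 1)).hom x = 0 ∧ (ι.f n).hom x = z + (K.d (n - 1) n).hom h := by
  obtain ⟨w, hw⟩ := exists_cycles_of_d_eq_zero K n z hz
  obtain ⟨y, hy⟩ := hsurj ((K.homologyπ n).hom w)
  obtain ⟨v, rfl⟩ := exists_homologyπ_eq K' n y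
  rw [homologyMap_homologyπ_apply, ← sub_eq_zero, ← map_sub, homologyπ_eq_zero_iff_exists_toCycles] at hy
  obtain ⟨h, hh⟩ := hy
  refine ⟨(K'.iCycles n).hom v, h, d_iCycles_apply K' n v, ?_⟩
  have := congrArg (fun t => (K.iCycles n).hom t) hh
  simp only [map_sub] at this
  rw [iCycles_toCycles_apply, iCycles_cyclesMap_apply, hw] at this
  rw [this, add_sub_cancel]

/-- **The `g`-cocycles of `K` lie in the image of `ι^g`** when `H^g(ι)` is onto and `ι^{g-1}` is onto (correct `ι x = z + d h` by `h = ι w`).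
Indices free: `i + 1 = j`, `j + 1 = l`. [cite: Weibel1994, §1.1 (p. 2), 1.2.7 (p. 9)] -/
theorem ker_d_le_range_of_quasiIsoAt (i j l : ℤ) (hij : i + 1 = j) (hjl : j + 1 = l) [QuasiIsoAt ι j]
    (hprev : Function.Surjective (ι.f i).hom) : LinearMap.ker (K.d j l).hom ≤ LinearMap.range (ι.f j).hom := by
  subst hjl
  obtain rfl : i = j - 1 := by omega
  intro z hz
  have hsurj : Function.Surjective (homologyMap ι j).hom := by
    haveI : IsIso (homologyMap ι j) := (quasiIsoAt_iff_isIso_homologyMap ι j).1 inferInstance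
    exact (ModuleCat.epi_iff_surjective _).1 inferInstance
  obtain ⟨x, h, -, hx⟩ := exists_eq_add_d_of_homologyMap_surjective ι j hsurj z hz
  obtain ⟨w, rfl⟩ := hprev h
  refine ⟨x - (K'.d (j - 1) j).hom w, ?_⟩
  rw [map_sub, hx, ← topRepl_comm_apply, add_sub_cancel_right]

/-- **The image of `ι^g` consists of `g`-cocycles** when `K'` vanishes in degree `g + 1`. [cite: Weibel1994, 1.2.7 (p. 9)] -/
theorem range_le_ker_d_of_subsingleton (j l : ℤ) [Subsingleton (K'.X l)] :
    LinearMap.range (ι.f j).hom ≤ LinearMap.ker (K.d j l).hom := by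
  rintro _ ⟨x, rfl⟩
  rw [LinearMap.mem_ker, topRepl_comm_apply, Subsingleton.elim ((K'.d j l).hom x) 0, map_zero]

variable (M : Type u) [AddCommGroup M] [Module R M]

/-- A form `φ` on `K^b` killing `im d^{ab}_K` restricts along `ι^b` to a form killing `im d^{ab}_{K'}` (private helper). [folklore] -/
private theorem topRepl_lcomp_comp_eq_zero (a b : ℤ) (φ : K.X b →ₗ[R] M) (hφ : LinearMap.lcomp R M (K.d a b).hom φ = 0) :
    LinearMap.lcomp R M (K'.d a b).hom (φ ∘ₗ (ι.f b).hom) = 0 := by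
  ext x
  have := LinearMap.congr_fun hφ ((ι.f a).hom x)
  rw [LinearMap.lcomp_apply, LinearMap.zero_apply, topRepl_comm_apply] at this
  rw [LinearMap.lcomp_apply, LinearMap.zero_apply, LinearMap.comp_apply]
  exact this

/-- **Transfer of exactness of `Hom(−, M)` below the top**: if `ι^b` is onto and every form on `K'^c` extends along `ι^c`, exactness of
`Hom(K'^c, M) → Hom(K'^b, M) → Hom(K'^a, M)` implies exactness of `Hom(K^c, M) → Hom(K^b, M) → Hom(K^a, M)` (precomposition with the
differentials; no relation among `a, b, c` is needed). [cite: Weibel1994, §1.1 (p. 2), 1.2.7 (p. 9)] [cite: BrunsHerzog1998, §1.1 (p. 4)] -/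
theorem exact_lcomp_of_exact_lcomp_of_surjective (a b c : ℤ) (hb : Function.Surjective (ι.f b).hom)
    (hc : ∀ φ' : K'.X c →ₗ[R] M, ∃ φ : K.X c →ₗ[R] M, φ ∘ₗ (ι.f c).hom = φ')
    (hex : Function.Exact (LinearMap.lcomp R M (K'.d b c).hom) (LinearMap.lcomp R M (K'.d a b).hom)) :
    Function.Exact (LinearMap.lcomp R M (K.d b c).hom) (LinearMap.lcomp R M (K.d a b).hom) := by
  intro φ
  constructor
  · intro hφ
    obtain ⟨ψ', hψ'⟩ := (hex _).1 (topRepl_lcomp_comp_eq_zero ι M a b φ hφ)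
    obtain ⟨ψ, hψ⟩ := hc ψ'
    refine ⟨ψ, ?_⟩
    ext y
    obtain ⟨x, rfl⟩ := hb y
    have e1 := LinearMap.congr_fun hψ ((K'.d b c).hom x)
    have e2 := LinearMap.congr_fun hψ' x
    rw [LinearMap.comp_apply] at e1
    rw [LinearMap.lcomp_apply, LinearMap.comp_apply] at e2
    rw [LinearMap.lcomp_apply, topRepl_comm_apply, e1, e2]
  · rintro ⟨ψ, rfl⟩
    ext y
    rw [LinearMap.lcomp_apply, LinearMap.lcomp_apply, LinearMap.zero_apply, topRepl_d_d_apply, map_zero]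

/-- **Transfer of exactness of `Hom(−, M)` at the top**: if `K'^c = 0`, `d^{bc}_K` is onto and the kernel of `d^{bc}_K` lies in the image of
`ι^b`, exactness of `Hom(K'^c, M) → Hom(K'^b, M) → Hom(K'^a, M)` (i.e. injectivity of `∘ d^{ab}_{K'}`) implies exactness of
`Hom(K^c, M) → Hom(K^b, M) → Hom(K^a, M)`: a form killing `im d^{ab}_K` kills `im ι^b ⊇ ker d^{bc}_K`, so factors through `d^{bc}_K` (§1).
[cite: Weibel1994, §1.1 (p. 2), 1.2.7 (p. 9)] [cite: BrunsHerzog1998, §1.1 (p. 4)] -/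
theorem exact_lcomp_of_exact_lcomp_top (a b c : ℤ) [Subsingleton (K'.X c)] (hd : Function.Surjective (K.d b c).hom)
    (hcyc : LinearMap.ker (K.d b c).hom ≤ LinearMap.range (ι.f b).hom)
    (hex : Function.Exact (LinearMap.lcomp R M (K'.d b c).hom) (LinearMap.lcomp R M (K'.d a b).hom)) :
    Function.Exact (LinearMap.lcomp R M (K.d b c).hom) (LinearMap.lcomp R M (K.d a b).hom) := by
  intro φ
  constructor
  · intro hφ
    obtain ⟨ψ', hψ'⟩ := (hex _).1 (topRepl_lcomp_comp_eq_zero ι M a b φ hφ)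
    have hψ'0 : ψ' = 0 := LinearMap.ext fun x => by rw [Subsingleton.elim x 0, map_zero, LinearMap.zero_apply]
    have hφι : φ ∘ₗ (ι.f b).hom = 0 := by rw [← hψ', hψ'0, map_zero]
    obtain ⟨ψ, hψ⟩ := exists_eq_comp_of_ker_le_ker (K.d b c).hom hd φ fun y hy => by
      obtain ⟨x, rfl⟩ := hcyc hy
      rw [LinearMap.mem_ker, ← LinearMap.comp_apply, hφι, LinearMap.zero_apply]
    exact ⟨ψ, by rw [LinearMap.lcomp_apply', hψ]⟩
  · rintro ⟨ψ, rfl⟩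
    ext y
    rw [LinearMap.lcomp_apply, LinearMap.lcomp_apply, LinearMap.zero_apply, topRepl_d_d_apply, map_zero]

/-- Exactness of `Hom_R(L•, M)` at `p`, in the form «`ker(∘ d_L^{-p-1,-p}) = im(∘ d_L^{-p,-p+1})`» (private helper). [folklore] -/
private theorem homComplex_exactAt_iff (L : CochainComplex (ModuleCat.{u} R) ℤ) (p : ℤ) :
    (homComplex L M).ExactAt p ↔
      Function.Exact (LinearMap.lcomp R M (L.d (-p) (-(p - 1))).hom) (LinearMap.lcomp R M (L.d (-(p + 1)) (-p)).hom) := by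
  rw [(homComplex L M).exactAt_iff' (p - 1) p (p + 1) (by simp) (by simp),
    CategoryTheory.ShortComplex.ShortExact.moduleCat_exact_iff_function_exact]
  rfl

/-- **★ B2 THROUGH A TOP REPLACEMENT.**  Let `R` be LOCAL with a weakly regular sequence `rs` of length `≥ g`, `K•` a cochain complex of finite
free `R`-modules, exact at every degree `< g`, with `d^g : K^g ↠ K^{g+1}` onto and every `r ∈ rs` acting locally nilpotently on the `g`-cocycles
modulo coboundaries; and let `ι : K'• → K•` be a cochain map bijective in degrees `< g`, injective in degree `g`, a quasi-isomorphism in degrees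
`≤ g`, with `K'` vanishing above `g` (e.g. the canonical truncation `τ_{≤ g} K•`).  Then `Hom_R(K•, R)` is exact at every degree `-g ≤ p < 0`.
Proof: `K'` satisfies the hypotheses of ★ `homComplex_exactAt_of_neg` (its degree-`g` term `≅ ker d^g` is a direct summand of `K^g`, free
over the local ring; exactness and torsion transfer through `ι`), and §2 transfers the exactness of `Hom_R(K'•, R)` back to `Hom_R(K•, R)`.
[cite: MumfordAV1970, §13 (pp. 125–130)] [cite: Weibel1994, 1.2.7 (p. 9)] [cite: PeskineSzpiro1973, Lemme (1.8)] -/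
theorem homComplex_exactAt_of_neg_of_topReplacement [IsLocalRing R] (g : ℤ) (rs : List R) (hrs : IsWeaklyRegular R rs)
    (hlen : g ≤ rs.length) (hfree : ∀ i, Module.Free R (K.X i)) (hfin : ∀ i, Module.Finite R (K.X i))
    (hd : Function.Surjective (K.d g (g + 1)).hom) (hexK : ∀ j, j < g → K.ExactAt j)
    (hnil : ∀ r ∈ rs, ∀ i, i + 1 = g → ∀ x : K.X g, (K.d g (g + 1)).hom x = 0 → ∃ (k : ℕ) (w : K.X i), r ^ k • x = (K.d i g).hom w)
    (hiso : ∀ i, i < g → Function.Bijective (ι.f i).hom) (hinj : Function.Injective (ι.f g).hom)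
    (hq : ∀ j, j ≤ g → QuasiIsoAt ι j) (hzero' : ∀ i, g < i → Subsingleton (K'.X i))
    (p : ℤ) (hp : p < 0) (hpg : -g ≤ p) : (homComplex K R).ExactAt p := by
  -- free-index forms of the top-degree data
  have hd' : ∀ i j, i = g → i + 1 = j → Function.Surjective (K.d i j).hom := by
    rintro i j rfl rfl; exact hd
  have hrange : LinearMap.range (ι.f g).hom = LinearMap.ker (K.d g (g + 1)).hom := by
    haveI := hzero' (g + 1) (by omega)
    haveI := hq g le_rfl
    exact le_antisymm (range_le_ker_d_of_subsingleton ι g (g + 1))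
      (ker_d_le_range_of_quasiIsoAt ι (g - 1) g (g + 1) (by omega) rfl (hiso (g - 1) (by omega)).2)
  -- the degree-`g` term of `K'` is a direct summand of `K^g`
  haveI := hfree g; haveI := hfin g; haveI := hfree (g + 1)
  obtain ⟨s, hs⟩ := exists_retraction_of_range_eq_ker (ι.f g).hom hinj (K.d g (g + 1)).hom hd hrange
  have hs' : Function.Surjective s := Function.LeftInverse.surjective (g := (ι.f g).hom) fun z => LinearMap.congr_fun hs z
  -- the hypotheses of ★ B2 for `K'`
  have hfree' : ∀ i, Module.Free R (K'.X i) := by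
    intro i
    rcases lt_trichotomy i g with hi | rfl | hi
    · exact Module.Free.of_equiv (LinearEquiv.ofBijective (ι.f i).hom (hiso i hi)).symm
    · haveI : Module.Projective R (K'.X i) := Module.Projective.of_split (ι.f i).hom s hs
      haveI : Module.Finite R (K'.X i) := Module.Finite.of_surjective s hs'
      exact Module.free_of_flat_of_isLocalRing
    · haveI := hzero' i hi
      exact Module.Free.of_subsingleton R _
  have hfin' : ∀ i, Module.Finite R (K'.X i) := by
    intro i
    rcases lt_trichotomy i g with hi | rfl | hi
    · haveI := hfin i
      exact Module.Finite.equiv (LinearEquiv.ofBijective (ι.f i).hom (hiso i hi)).symm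
    · exact Module.Finite.of_surjective s hs'
    · haveI := hzero' i hi
      exact Module.Finite.of_surjective (0 : R →ₗ[R] K'.X i) fun x => ⟨0, Subsingleton.elim _ _⟩
  have hex' : ∀ (i j l : ℤ), i + 1 = j → j + 1 = l → j < g → Function.Exact (K'.d i j).hom (K'.d j l).hom := by
    intro i j l hij hjl hj
    haveI := hq j hj.le
    have := (exactAt_iff_of_quasiIsoAt ι j).2 (hexK j hj)
    rw [K'.exactAt_iff' i j l (by simp only [CochainComplex.prev]; omega) (by simp only [CochainComplex.next]; omega),
      CategoryTheory.ShortComplex.ShortExact.moduleCat_exact_iff_function_exact] at this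
    exact this
  have hnil' : ∀ r ∈ rs, ∀ i, i + 1 = g → ∀ x : K'.X g, ∃ (k : ℕ) (w : K'.X i), r ^ k • x = (K'.d i g).hom w := by
    intro r hr i hi x
    haveI := hq g le_rfl
    haveI := hzero' (g + 1) (by omega)
    have hinjH : Function.Injective (homologyMap ι g).hom := by
      haveI : IsIso (homologyMap ι g) := (quasiIsoAt_iff_isIso_homologyMap ι g).1 inferInstance
      exact (ModuleCat.mono_iff_injective _).1 inferInstance
    exact exists_pow_smul_eq_d_of_homologyMap_injective ι i g (g + 1) hi rfl hinjH r (hnil r hr i hi) x (Subsingleton.elim _ _)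
  have hK' := homComplex_exactAt_of_neg K' g rs hrs hlen hfree' hfin' hzero' hex' hnil' p hp
  -- transfer back to `K`
  rw [homComplex_exactAt_iff] at hK' ⊢
  by_cases hpg' : p = -g
  · haveI := hzero' (-(p - 1)) (by omega)
    haveI := hq (-p) (by omega)
    exact exact_lcomp_of_exact_lcomp_top ι R _ _ _ (hd' (-p) (-(p - 1)) (by omega) (by omega))
      (ker_d_le_range_of_quasiIsoAt ι (-(p + 1)) (-p) (-(p - 1)) (by omega) (by omega) (hiso _ (by omega)).2) hK'
  · refine exact_lcomp_of_exact_lcomp_of_surjective ι R _ _ _ (hiso (-p) (by omega)).2 (fun φ' => ?_) hK'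
    rcases lt_or_eq_of_le (show -(p - 1) ≤ g by omega) with hc | hc
    · let e := LinearEquiv.ofBijective (ι.f (-(p - 1))).hom (hiso _ hc)
      refine ⟨φ' ∘ₗ e.symm.toLinearMap, LinearMap.ext fun x => ?_⟩
      rw [LinearMap.comp_apply, LinearMap.comp_apply, LinearEquiv.coe_coe]
      exact congrArg φ' (e.symm_apply_apply x)
    · obtain ⟨s₁, hs₁⟩ : ∃ s₁ : K.X (-(p - 1)) →ₗ[R] K'.X (-(p - 1)), s₁ ∘ₗ (ι.f (-(p - 1))).hom = LinearMap.id := by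
        rw [hc]; exact ⟨s, hs⟩
      exact ⟨φ' ∘ₗ s₁, by rw [LinearMap.comp_assoc, hs₁, LinearMap.comp_id]⟩

end Transfer

/-! ## §3 The canonical truncation `τ_{≤ g}` and the hypothesis-free statement -/

section Truncation

variable {R : Type u} [CommRing R] (K : CochainComplex (ModuleCat.{u} R) ℤ)

set_option backward.isDefEq.respectTransparency false in
/-- **The canonical truncation is an isomorphism below the truncation degree**: `(τ_{≤ n} K → K)^i` is an isomorphism for `i < n`
(Mathlib's `truncLE` is the opposite of `truncGE`, whose projection is an isomorphism away from the boundary). [cite: Weibel1994, 1.2.7 (p. 9)] -/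
theorem isIso_ιTruncLE_f (n i : ℤ) (hi : i < n) : IsIso ((K.ιTruncLE n).f i) := by
  obtain ⟨k, hk⟩ : ∃ k : ℕ, n - ((k + 1 : ℕ) : ℤ) = i := ⟨(n - i - 1).toNat, by omega⟩
  have hb : ¬ (ComplexShape.embeddingUpIntLE n).op.BoundaryGE (k + 1) := by
    simpa using (ComplexShape.boundaryLE_embeddingUpIntLE_iff n (k + 1)).not.2 (by omega)
  have hf : (ComplexShape.embeddingUpIntLE n).op.f (k + 1) = i := by simpa using hk
  have : IsIso ((K.op.πTruncGE (ComplexShape.embeddingUpIntLE n).op).f i) := by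
    dsimp [HomologicalComplex.πTruncGE, HomologicalComplex.truncGE]
    rw [(ComplexShape.embeddingUpIntLE n).op.isIso_liftExtend_f_iff _ _ hf]
    exact K.op.isIso_restrictionToTruncGE' _ (k + 1) hb
  exact inferInstanceAs (IsIso ((K.op.πTruncGE (ComplexShape.embeddingUpIntLE n).op).f i).unop)

/-- **THE DUAL OF A FINITE FREE COMPLEX EXACT BELOW `g` WITH SURJECTIVE `d^g` IS EXACT IN DEGREES `[-g, 0)`.**  Let `R` be a LOCAL ring
carrying a weakly regular sequence `r_1, …, r_n` with `n ≥ g`, and `K•` a cochain complex of finite free `R`-modules which is exact at every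
degree `j < g`, whose differential `d^g : K^g → K^{g+1}` is SURJECTIVE (e.g. `K•` concentrated in `[0, g+1]` with `H^{g+1}(K•) = 0`), and such
that every `r_m` acts locally nilpotently on `H^g(K•)` (for each `g`-cocycle `x` some `r_m^k x` is a coboundary).  Then `Hom_R(K•, R)` (★
`homComplex K R`) is exact at every degree `-g ≤ p < 0`; for `g ≥ 1` in particular at `p = -1`, i.e. `Hom(K², R) → Hom(K¹, R) → Hom(K⁰, R)` is
exact — hypothesis `h₂` of ★ `finrank_HOne_baseChangeComplex_residueField_eq_finrank_cotangentSpace`.  (★ `homComplex_exactAt_of_neg` is the case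
`K^{g+1} = 0`; the general case passes through the canonical truncation `τ_{≤ g} K• → K•`, §2.)  This is the local algebra of [MumfordAV1970] §13 for
the Grothendieck complex of the Poincaré bundle over `𝒪_{Â,0̂}` computed from a `(g+1)`-member affine cover, whose strictly perfect model has
amplitude `[0, g+1]`. [cite: MumfordAV1970, §13 (pp. 125–130)] [cite: Weibel1994, 1.2.7 (p. 9)] [cite: PeskineSzpiro1973, Lemme (1.8)]
[cite: BrunsHerzog1998, §1.3 (pp. 16–17)] -/
theorem homComplex_exactAt_of_surjective_d_top [IsLocalRing R] (g : ℤ) (rs : List R) (hrs : IsWeaklyRegular R rs)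
    (hlen : g ≤ rs.length) (hfree : ∀ i, Module.Free R (K.X i)) (hfin : ∀ i, Module.Finite R (K.X i))
    (hd : Function.Surjective (K.d g (g + 1)).hom) (hex : ∀ j, j < g → K.ExactAt j)
    (hnil : ∀ r ∈ rs, ∀ i, i + 1 = g → ∀ x : K.X g, (K.d g (g + 1)).hom x = 0 → ∃ (k : ℕ) (w : K.X i), r ^ k • x = (K.d i g).hom w)
    (p : ℤ) (hp : p < 0) (hpg : -g ≤ p) : (homComplex K R).ExactAt p := by
  refine homComplex_exactAt_of_neg_of_topReplacement (K.ιTruncLE g) g rs hrs hlen hfree hfin hd hex hnil (fun i hi => ?_) ?_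
    (fun j hj => K.quasiIsoAt_ιTruncLE g j hj) (fun i hi => ?_) p hp hpg
  · haveI := isIso_ιTruncLE_f K g i hi
    exact ⟨(ModuleCat.mono_iff_injective _).1 inferInstance, (ModuleCat.epi_iff_surjective _).1 inferInstance⟩
  · exact (ModuleCat.mono_iff_injective _).1
      (inferInstanceAs (Mono ((HomologicalComplex.ιTruncLE K (ComplexShape.embeddingUpIntLE g)).f g)))
  · haveI : (K.truncLE g).IsStrictlyLE g :=
      inferInstanceAs ((HomologicalComplex.truncLE K (ComplexShape.embeddingUpIntLE g)).IsStrictlySupported _)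
    exact ModuleCat.isZero_iff_subsingleton.1 ((K.truncLE g).isZero_of_isStrictlyLE g i hi)

end Truncation

end Literature.Algebra.Homology
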